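import Summits.HodgeConjecture.HodgeConjecture.Theorems.F0P3cStCharTSWeylCartanWIF     -- ★-cand (E2b) (this seat): `integral_mul_classFun_eq_sum_classOrbitalIntegral_of_tubeJacobians`
import Literature.NumberTheory.Rogawski1990.Ch12Sec5                                   -- ★ `Ch12Sec5.EllipticData.WeylIntegrationFormula`, `weylOrder`, `orbInt`, `IsClassFunOn`
import HarnessLib

/-!
# F0 · P3c · line LH6 «StCharTS» — «ELL-TOR★» (E4) «WIF AT THE DATUM BY SHAPE»: the RUNG0 named-block antecedent `hWIF : 𝔇.WeylIntegrationFormula` of the (S-𝔇) organ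
# DISCHARGED from the pins of the constructed datum and the two analytic sockets (singular set null; local tube Jacobians on a system of Cartan representatives)
# (Rogawski 1990 §12.5 p. 182; Harish-Chandra 1970 Lemmas 20, 22, 42)

Cell `pub/hodgecm-mathlib`, crux H413 = `stmt-HodgeConjecture-24833` (lane `--supports`, helper); seat F0P3a-p05 (g22); road «ELL-TOR★» (NAMING 2026-09-02T14:19:42Z, «=» LH6-p03
(g5) 14:22:45Z).  THEOREMS ONLY; sorry-free; no definition ∕ instance ∕ notation ∕ named fact; ★-only imports; axioms TRIO.

THE POINT.  ★ `Ch12Sec5.EllipticData.WeylIntegrationFormula 𝔇` is print's display [Rogawski1990 §12.5 p. 182] over the datum's fields: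
`∫ f α ∂𝔇.μG = Σ_{T ∈ 𝔇.cartanAll} (weylOrder T)⁻¹ · ∫_T (𝔇.DG t)² · 𝔇.orbInt t f · α t ∂(𝔇.μT T)` for `f` Schwartz–Bruhat and `α` a measurable class function on `𝔇.regG`.  It is the
`hWIF` antecedent of the LH6 rung-0 block (★ `F0P3cStCharTSDatumJunction*`, RUNG0 pen LH6-p01), so far a PRINTED input.  This file proves it — in the shape of a theorem ABOUT ANY
DATUM whose relevant fields are pinned as the map owner's PIN TABLE (MAP v5 §3) pins them — from the two analytic sockets of the «ELL-TOR★» chain: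
* PINS (hypotheses `=` on fields, road rule §2.1): `𝔇.μG = ν` Haar; `𝔇.orb` CANONICAL for the regular classes w.r.t. `ν` (the organ's `hcanQ`); `𝔇.regG = {regular}` (★ S2); `𝔇.cartanAll
  = image of an injective family `T : ι → Subgroup G` of Cartan subgroups `T i = Z(γ i)`, pairwise non-conjugate, meeting every class (CARTAN-FIN ∕ ★ `exists_normalised_cartan_family`
  shape); `𝔇.μT (T i) = t_{T i}` THE Haar measure of mass one on the compact core (★ (E3); PLAN-S9 D4); `(𝔇.DG t)² = D i t` on `(T i)^{reg}` and `𝔇.DG t = 0` off it (PLAN-S9 D5, ★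
  DG-FIELD's closed formula; `D i` the Jacobian weight);
* SOCKET (by shape): `hJac i` — the local tube Jacobian at `T i` with weight `D i` (★ (E1b)'s `hJacLoc`; at `M` = the JAC-LOC road (LH6-p03), at compact `T i` = «JAC-ELL» (LH5-p02));
  the other classical input, «the singular set is Haar-null» [HC1970 L. 42], is ★ (J8) «SINGULAR-NULL-G» (LH5-p03) and is used by name inside ★ (E2b);
THEN **`𝔇.WeylIntegrationFormula`** (`weylIntegrationFormula_of_pins_of_tubeJacobians`).  PROOF: ★ (E2b) §3 gives print's display with `[N(T):T]`, `D`, `classOrbitalIntegral 𝔇.orb` and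
`t_T` (the singular set being null by ★ (J8)); `weylOrder T = [N(T):T]` (`rfl`: ★ `weylOrder` is `Nat.card` of the coset space = `Subgroup.index`), `𝔇.orbInt t f = classOrbitalIntegral 𝔇.orb f ⟦t⟧` (`rfl`), the integrand of
WIF vanishes off `(T i)^{reg}` (`𝔇.DG = 0` there), and real scalars act on `ℂ` by multiplication.
HONEST LABEL: count-neutral; this discharges `hWIF` only CONDITIONALLY on the `hJac i` (true statements of `p`-adic analysis; in-house roads JAC-LOC ∕ JAC-ELL in flight) and on the pins of the
constructed datum; closes no organ by itself.  HC_CM is proved only modulo the 7 printed citations (2 remaining: hLiu418 = `stmt-HodgeConjecture-24832`, h413 = `stmt-HodgeConjecture-24833`)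
until rung 0 closes.

## References
* [Rogawski1990] J. D. Rogawski, *Automorphic Representations of Unitary Groups in Three Variables*, Ann. of Math. Stud. 123 (1990), §12.5 p. 182 (the Weyl integration formula), §3.6 p. 29
  (`|Ω(T, G)|`), §4.3 (4.3.1) p. 43 (`Φ(γ, f)`).
* [HarishChandra1970] Harish-Chandra (notes by G. van Dijk), *Harmonic analysis on reductive p-adic groups*, LNM 162 (1970), Part V §3 Lemma 20, §4 Lemma 22, Lemma 42.
-/

set_option autoImplicit false
-- the mandated namespace has the single-problem summit's repeated segment (`HodgeConjecture.HodgeConjecture`)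
set_option linter.dupNamespace false

noncomputable section

open MeasureTheory Measure Set Filter Topology Function NumberField IsDedekindDomain Matrix Polynomial
open Literature.MeasureTheory.Group
open Literature.NumberTheory.Automorphic Literature.NumberTheory.Automorphic.UnitaryGroup Literature.NumberTheory.Rogawski1990
open Summit.HodgeConjecture.HodgeConjecture.Cruxes.H413.F0P3cStCharTSWeylCartanRadial
open Summit.HodgeConjecture.HodgeConjecture.Cruxes.H413.F0P3cStCharTSWeylCartanWIF
open scoped ENNReal NNReal MatrixGroups Pointwise

namespace Summit.HodgeConjecture.HodgeConjecture.Cruxes.H413.F0P3cStCharTSWeylCartanDatumWIF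

/-- `weylOrder T = [N(T) : T]` (★ `weylOrder` is `Nat.card` of the coset space of `T` in its normaliser, i.e. `Subgroup.index`). [cite: Rogawski1990, §3.6 p. 29] -/
theorem weylOrder_eq_index {G : Type*} [Group G] (S : Subgroup G) : Ch12Sec5.weylOrder S = (S.subgroupOf (Subgroup.normalizer (S : Set G))).index := rfl

section CM

variable {L : Type} [Field L] [NumberField L] [IsCMField L] {v : HeightOneSpectrum (𝓞 ↥(maximalRealSubfield L))}
  {ι : Type} [Fintype ι] [DecidableEq (Subgroup (Gqs L v))] {T : ι → Subgroup (Gqs L v)} {γ : ι → Gqs L v}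
  (hγ : ∀ i, IsRegularElt ((γ i).val : GL (Fin 3) (LocalRing L v))) (hT : ∀ i, T i = Subgroup.centralizer ({γ i} : Set (Gqs L v)))
  (hnc : ∀ i j, i ≠ j → ∀ y : Gqs L v, ¬ ∀ h : Gqs L v, h ∈ T j ↔ y⁻¹ * h * y ∈ T i)
  (hcov : ∀ g : Gqs L v, IsRegularElt (g.val : GL (Fin 3) (LocalRing L v)) →
    ∃ i, ∃ x : Gqs L v, ∀ h : Gqs L v, h ∈ Subgroup.centralizer ({g} : Set (Gqs L v)) ↔ x⁻¹ * h * x ∈ T i)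
  (hns : ∀ w : PlacesOver L v, IsCMField.complexConj L • w.1 = w.1)
  [MeasurableSpace (Gqs L v)] [BorelSpace (Gqs L v)] [LocallyCompactSpace (Gqs L v)] [SecondCountableTopology (Gqs L v)] [T2Space (Gqs L v)]
  [∀ γ' : Gqs L v, MeasurableSpace (Gqs L v ⧸ Subgroup.centralizer ({γ'} : Set (Gqs L v)))]
  [∀ γ' : Gqs L v, BorelSpace (Gqs L v ⧸ Subgroup.centralizer ({γ'} : Set (Gqs L v)))]
  [MeasurableSpace (Gqs L v ⧸ Subgroup.center (Gqs L v))]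
  [∀ i, MeasurableSpace (Gqs L v ⧸ T i)] [∀ i, BorelSpace (Gqs L v ⧸ T i)]
  {Hv : Type} [Group Hv] [TopologicalSpace Hv] [IsTopologicalGroup Hv] [MeasurableSpace Hv]
  (ν : Measure (Gqs L v)) [ν.IsHaarMeasure] [ν.IsMulRightInvariant]
  (Φ : ∀ i, (Gqs L v ⧸ T i) × ↥(T i) → Gqs L v) (hΦ : ∀ i (x : Gqs L v) (t : ↥(T i)), Φ i (QuotientGroup.mk x, t) = x * t * x⁻¹)
  (tT : ∀ i, Measure ↥(T i)) [∀ i, (tT i).IsHaarMeasure] [∀ i, (tT i).IsInvInvariant] (htT : ∀ i, tT i (compactCore ↥(T i)) = 1)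
  (D : ∀ i, ↥(T i) → ℝ≥0) (hD : ∀ i, Measurable (D i))

set_option maxHeartbeats 1600000 in
set_option synthInstance.maxHeartbeats 200000 in
-- instance-term unification on the CM local carrier (`quotientMeasure` per `i`), as in ★ (E1b) ∕ (E2b)
include hγ hnc hcov hns hΦ htT hD in
/-- **«WIF AT THE DATUM BY SHAPE»: `𝔇.WeylIntegrationFormula` FROM THE PINS AND THE TWO SOCKETS.**  For ANY §12.5 datum `𝔇 : EllipticData (Gqs L v) Hv` (`v` non-split) whose fields
are pinned as in the module docstring — `𝔇.μG = ν` Haar, `𝔇.orb` canonical for the regular classes, `𝔇.regG = {regular}`, `𝔇.cartanAll = image T` of an injective, pairwise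
non-conjugate, covering family of Cartan subgroups `T i = Z(γ i)`, `𝔇.μT (T i) = t_{T i}` (Haar, mass one on the compact core), `(𝔇.DG)² = D i` on `(T i)^{reg}` and `𝔇.DG = 0` off it —
and GIVEN the local tube Jacobians `hJac i` (★ (E1b)'s socket, weight `D i`) — the singular set being Haar-null by ★ (J8) — the Weyl integration formula of [Rogawski1990 §12.5 p. 182] holds at `𝔇`:
**`𝔇.WeylIntegrationFormula`**. [cite: Rogawski1990, §12.5 p. 182; §3.6 p. 29; §4.3 (4.3.1) p. 43] [cite: HarishChandra1970, Lemma 20; Lemma 22; Lemma 42] -/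
theorem weylIntegrationFormula_of_pins_of_tubeJacobians (𝔇 : Ch12Sec5.EllipticData (Gqs L v) Hv)
    (hμG : 𝔇.μG = ν)
    (hcanQ : 𝔇.orb.IsCanonical (fun γ' : Gqs L v => IsRegularElt (γ'.val : GL (Fin 3) (LocalRing L v))) ν)
    (hreg : 𝔇.regG = {g : Gqs L v | IsRegularElt (g.val : GL (Fin 3) (LocalRing L v))})
    (hcartan : 𝔇.cartanAll = Finset.univ.image T) (hTinj : Function.Injective T)
    (hμT : ∀ i, 𝔇.μT (T i) = tT i)
    (hDGsq : ∀ i (t : ↥(T i)), IsRegularElt (((t : Gqs L v)).val : GL (Fin 3) (LocalRing L v)) → 𝔇.DG (t : Gqs L v) ^ 2 = (D i t : ℝ))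
    (hDG0 : ∀ i (t : ↥(T i)), ¬ IsRegularElt (((t : Gqs L v)).val : GL (Fin 3) (LocalRing L v)) → 𝔇.DG (t : Gqs L v) = 0)
    (hJac : ∀ i, ∀ t₀ : ↥(T i), IsRegularElt (((t₀ : Gqs L v)).val : GL (Fin 3) (LocalRing L v)) →
      ∃ U : Set ↥(T i), IsOpen U ∧ t₀ ∈ U ∧
        ∃ A₀ : Set (Gqs L v ⧸ T i), MeasurableSet A₀ ∧ (quotientMeasure (T i) (tT i) (isClosed_cartan (hT i)) ν) A₀ ≠ 0 ∧
          (quotientMeasure (T i) (tT i) (isClosed_cartan (hT i)) ν) A₀ ≠ ∞ ∧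
          ∀ V : Set ↥(T i), MeasurableSet V → V ⊆ U → (∀ t ∈ V, IsRegularElt (((t : Gqs L v)).val : GL (Fin 3) (LocalRing L v))) →
            (∀ n : Gqs L v, n ∉ T i → ∀ t ∈ V, ∀ t' ∈ V, ((t' : ↥(T i)) : Gqs L v) ≠ n * t * n⁻¹) →
              ν (Φ i '' (A₀ ×ˢ V)) = (quotientMeasure (T i) (tT i) (isClosed_cartan (hT i)) ν) A₀ * ∫⁻ t in V, (D i t : ℝ≥0∞) ∂(tT i)) :
    𝔇.WeylIntegrationFormula := by
  intro f hf α _hαm hαcl hint _hintT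
  have hfm : Measurable f := hf.1.continuous.measurable
  have hα : ∀ x t : Gqs L v, IsRegularElt (t.val : GL (Fin 3) (LocalRing L v)) → α (x * t * x⁻¹) = α t := fun x t ht =>
    hαcl t (by rw [hreg]; exact ht) x
  rw [hμG] at hint
  rw [hμG, integral_mul_classFun_eq_sum_classOrbitalIntegral_of_tubeJacobians hγ hT hnc hcov hns ν Φ hΦ hcanQ tT htT D hD hJac f α hfm hα hint,
    hcartan, Finset.sum_image fun i _ j _ h => hTinj h]
  refine Finset.sum_congr rfl fun i _ => ?_
  -- the `i`-th summand: `[N:T]⁻¹ • ∫_{T^{reg}} D • (α · Φ) d t_T = (weylOrder T)⁻¹ * ∫_T DG² · orbInt · α d(μT T)`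
  obtain ⟨w⟩ := (inferInstance : Nonempty (PlacesOver L v))
  have hSm : MeasurableSet {t : ↥(T i) | IsRegularElt (((t : Gqs L v)).val : GL (Fin 3) (LocalRing L v))} :=
    ((isOpen_setOf_isRegularElt_cmDatum_local (L := L) (H := qsForm L) (v := v) w (hns w)).preimage continuous_subtype_val).measurableSet
  rw [weylOrder_eq_index, hμT i, Complex.real_smul, Complex.ofReal_inv, Complex.ofReal_natCast]
  congr 1
  -- the integrand of WIF vanishes off `T^{reg}` (`𝔇.DG = 0` there), and on `T^{reg}` equals `D • (α · classOrbitalIntegral)`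
  have hvan : ∀ t : ↥(T i), t ∉ {t : ↥(T i) | IsRegularElt (((t : Gqs L v)).val : GL (Fin 3) (LocalRing L v))} →
      ((𝔇.DG (t : Gqs L v) : ℂ) ^ 2 * 𝔇.orbInt (t : Gqs L v) f * α (t : Gqs L v)) = 0 := fun t ht => by
    rw [hDG0 i t ht, Complex.ofReal_zero, zero_pow two_ne_zero, zero_mul, zero_mul]
  rw [← setIntegral_eq_integral_of_forall_compl_eq_zero hvan]
  refine setIntegral_congr_fun hSm fun t ht => ?_
  simp only [Ch12Sec5.EllipticData.orbInt]
  rw [Complex.real_smul, ← Complex.ofReal_pow, hDGsq i t ht]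
  ring

end CM

/-! ## §2 (ED. 2) The `Finset` form: the Weyl integration formula at the datum straight from a CARTAN-ALL family `cartanAll : Finset (Subgroup G)` -/

section Finset

variable {L : Type} [Field L] [NumberField L] [IsCMField L] {v : HeightOneSpectrum (𝓞 ↥(maximalRealSubfield L))}

/-- A subgroup presented as `Z(γ₀)` with `γ₀` regular is closed (★ p851692 `isClosed_cartan`, ∃-form for the `Finset` interface). [cite: Rogawski1990, §3.1 p. 19] -/
theorem isClosed_of_exists_eq_centralizer [T2Space (Gqs L v)] {T : Subgroup (Gqs L v)}
    (h : ∃ γ₀ : Gqs L v, IsRegularElt (γ₀.val : GL (Fin 3) (LocalRing L v)) ∧ T = Subgroup.centralizer ({γ₀} : Set (Gqs L v))) :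
    IsClosed (T : Set (Gqs L v)) := by
  obtain ⟨γ₀, -, rfl⟩ := h
  exact isClosed_coe_centralizer L v γ₀

set_option maxHeartbeats 1600000 in
set_option synthInstance.maxHeartbeats 200000 in
-- instance-term unification on the CM local carrier (`quotientMeasure` per representative), as in §1
/-- **«WIF AT THE DATUM», `Finset` FORM — consumes ★ CARTAN-ALL (`F0P3cStCharTSCartanAll.exists_cartanAll_weylShape`, F0P3a-p03 (g24)) TOKEN FOR TOKEN.**  For a finite family
`S : Finset (Subgroup (Gqs L v))` of Cartan subgroups (`hS : ∀ T ∈ S, ∃ γ₀ regular, T = Z(γ₀)`) meeting every conjugacy class (`hcov`) and pairwise non-conjugate (`hnc`) — the three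
clauses of ★ `exists_cartanAll_weylShape` — and per-representative data indexed by `↥S` (conjugation families `Φ`, the normalised Haar measures `tT`, weights `D`, and the local tube
Jacobians `hJac`, ★ (E1b)'s socket), every datum `𝔇` with `𝔇.μG = ν`, `𝔇.orb` canonical, `𝔇.regG = {regular}`, **`𝔇.cartanAll = S`**, `𝔇.μT T = tT T`, `(𝔇.DG)² = D` on the regular
part of each `T ∈ S` and `𝔇.DG = 0` off it, satisfies **`𝔇.WeylIntegrationFormula`** (§1 at `ι := ↥S`, `Finset.univ.image Subtype.val = S`).
[cite: Rogawski1990, §12.5 p. 182; §3.6 pp. 28–31] [cite: HarishChandra1970, Lemma 20; Lemma 22; Lemma 42] -/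
theorem weylIntegrationFormula_of_cartanFinset_of_tubeJacobians [DecidableEq (Subgroup (Gqs L v))]
    (S : Finset (Subgroup (Gqs L v)))
    (hS : ∀ T ∈ S, ∃ γ₀ : Gqs L v, IsRegularElt (γ₀.val : GL (Fin 3) (LocalRing L v)) ∧ T = Subgroup.centralizer ({γ₀} : Set (Gqs L v)))
    (hcov : ∀ g : Gqs L v, IsRegularElt (g.val : GL (Fin 3) (LocalRing L v)) →
      ∃ T ∈ S, ∃ x : Gqs L v, ∀ h : Gqs L v, h ∈ Subgroup.centralizer ({g} : Set (Gqs L v)) ↔ x⁻¹ * h * x ∈ T)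
    (hnc : ∀ T ∈ S, ∀ T' ∈ S, T ≠ T' → ∀ y : Gqs L v, ¬ ∀ h : Gqs L v, h ∈ T' ↔ y⁻¹ * h * y ∈ T)
    (hns : ∀ w : PlacesOver L v, IsCMField.complexConj L • w.1 = w.1)
    [MeasurableSpace (Gqs L v)] [BorelSpace (Gqs L v)] [LocallyCompactSpace (Gqs L v)] [SecondCountableTopology (Gqs L v)] [T2Space (Gqs L v)]
    [∀ γ' : Gqs L v, MeasurableSpace (Gqs L v ⧸ Subgroup.centralizer ({γ'} : Set (Gqs L v)))]
    [∀ γ' : Gqs L v, BorelSpace (Gqs L v ⧸ Subgroup.centralizer ({γ'} : Set (Gqs L v)))]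
    [MeasurableSpace (Gqs L v ⧸ Subgroup.center (Gqs L v))]
    [∀ T : ↥S, MeasurableSpace (Gqs L v ⧸ (T : Subgroup (Gqs L v)))] [∀ T : ↥S, BorelSpace (Gqs L v ⧸ (T : Subgroup (Gqs L v)))]
    {Hv : Type} [Group Hv] [TopologicalSpace Hv] [IsTopologicalGroup Hv] [MeasurableSpace Hv]
    (ν : Measure (Gqs L v)) [ν.IsHaarMeasure] [ν.IsMulRightInvariant]
    (Φ : ∀ T : ↥S, (Gqs L v ⧸ (T : Subgroup (Gqs L v))) × ↥(T : Subgroup (Gqs L v)) → Gqs L v)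
    (hΦ : ∀ (T : ↥S) (x : Gqs L v) (t : ↥(T : Subgroup (Gqs L v))), Φ T (QuotientGroup.mk x, t) = x * t * x⁻¹)
    (tT : ∀ T : ↥S, Measure ↥(T : Subgroup (Gqs L v))) [∀ T, (tT T).IsHaarMeasure] [∀ T, (tT T).IsInvInvariant]
    (htT : ∀ T : ↥S, tT T (compactCore ↥(T : Subgroup (Gqs L v))) = 1)
    (D : ∀ T : ↥S, ↥(T : Subgroup (Gqs L v)) → ℝ≥0) (hD : ∀ T, Measurable (D T))
    (𝔇 : Ch12Sec5.EllipticData (Gqs L v) Hv)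
    (hμG : 𝔇.μG = ν)
    (hcanQ : 𝔇.orb.IsCanonical (fun γ' : Gqs L v => IsRegularElt (γ'.val : GL (Fin 3) (LocalRing L v))) ν)
    (hreg : 𝔇.regG = {g : Gqs L v | IsRegularElt (g.val : GL (Fin 3) (LocalRing L v))})
    (hcartan : 𝔇.cartanAll = S)
    (hμT : ∀ T : ↥S, 𝔇.μT (T : Subgroup (Gqs L v)) = tT T)
    (hDGsq : ∀ (T : ↥S) (t : ↥(T : Subgroup (Gqs L v))), IsRegularElt (((t : Gqs L v)).val : GL (Fin 3) (LocalRing L v)) → 𝔇.DG (t : Gqs L v) ^ 2 = (D T t : ℝ))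
    (hDG0 : ∀ (T : ↥S) (t : ↥(T : Subgroup (Gqs L v))), ¬ IsRegularElt (((t : Gqs L v)).val : GL (Fin 3) (LocalRing L v)) → 𝔇.DG (t : Gqs L v) = 0)
    (hJac : ∀ T : ↥S, ∀ t₀ : ↥(T : Subgroup (Gqs L v)), IsRegularElt (((t₀ : Gqs L v)).val : GL (Fin 3) (LocalRing L v)) →
      ∃ U : Set ↥(T : Subgroup (Gqs L v)), IsOpen U ∧ t₀ ∈ U ∧
        ∃ A₀ : Set (Gqs L v ⧸ (T : Subgroup (Gqs L v))), MeasurableSet A₀ ∧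
          (quotientMeasure (T : Subgroup (Gqs L v)) (tT T) (isClosed_of_exists_eq_centralizer (hS T T.2)) ν) A₀ ≠ 0 ∧
          (quotientMeasure (T : Subgroup (Gqs L v)) (tT T) (isClosed_of_exists_eq_centralizer (hS T T.2)) ν) A₀ ≠ ∞ ∧
          ∀ V : Set ↥(T : Subgroup (Gqs L v)), MeasurableSet V → V ⊆ U →
            (∀ t ∈ V, IsRegularElt (((t : Gqs L v)).val : GL (Fin 3) (LocalRing L v))) →
            (∀ n : Gqs L v, n ∉ (T : Subgroup (Gqs L v)) → ∀ t ∈ V, ∀ t' ∈ V, ((t' : ↥(T : Subgroup (Gqs L v))) : Gqs L v) ≠ n * t * n⁻¹) →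
              ν (Φ T '' (A₀ ×ˢ V)) =
                (quotientMeasure (T : Subgroup (Gqs L v)) (tT T) (isClosed_of_exists_eq_centralizer (hS T T.2)) ν) A₀ * ∫⁻ t in V, (D T t : ℝ≥0∞) ∂(tT T)) :
    𝔇.WeylIntegrationFormula := by
  classical
  -- the regular generators `γ T` of the representatives (by choice; the closedness proofs in `hJac` are irrelevant)
  have hγ' : ∀ T : ↥S, IsRegularElt ((Classical.choose (hS T T.2)).val : GL (Fin 3) (LocalRing L v)) := fun T => (Classical.choose_spec (hS T T.2)).1
  have hT' : ∀ T : ↥S, (T : Subgroup (Gqs L v)) = Subgroup.centralizer ({Classical.choose (hS T T.2)} : Set (Gqs L v)) :=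
    fun T => (Classical.choose_spec (hS T T.2)).2
  have hnc' : ∀ i j : ↥S, i ≠ j → ∀ y : Gqs L v, ¬ ∀ h : Gqs L v, h ∈ (j : Subgroup (Gqs L v)) ↔ y⁻¹ * h * y ∈ (i : Subgroup (Gqs L v)) :=
    fun i j hij => hnc i i.2 j j.2 fun h => hij (Subtype.ext h)
  have hcov' : ∀ g : Gqs L v, IsRegularElt (g.val : GL (Fin 3) (LocalRing L v)) →
      ∃ i : ↥S, ∃ x : Gqs L v, ∀ h : Gqs L v, h ∈ Subgroup.centralizer ({g} : Set (Gqs L v)) ↔ x⁻¹ * h * x ∈ (i : Subgroup (Gqs L v)) := by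
    intro g hg
    obtain ⟨T, hTS, x, hx⟩ := hcov g hg
    exact ⟨⟨T, hTS⟩, x, hx⟩
  have hcartan' : 𝔇.cartanAll = Finset.univ.image (fun T : ↥S => (T : Subgroup (Gqs L v))) := by
    rw [hcartan, Finset.univ_eq_attach, Finset.attach_image_val]
  exact weylIntegrationFormula_of_pins_of_tubeJacobians hγ' hT' hnc' hcov' hns ν Φ hΦ tT htT D hD 𝔇 hμG hcanQ hreg hcartan'
    (fun i j h => Subtype.ext h) hμT hDGsq hDG0 hJac

end Finset

end Summit.HodgeConjecture.HodgeConjecture.Cruxes.H413.F0P3cStCharTSWeylCartanDatumWIF
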